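import Mathlib
import Literature.Probability.LatticeModels.ProdBernoulliCoupling
import Summits.CriticalPhenomena.PercolationContinuityZ3.Theorems.PercNearOneGluingAdditiveGluingSigmaRecursion
import Summits.CriticalPhenomena.PercolationContinuityZ3.Theorems.PercNearOneGluingAdditiveGluingSigmaLaw
import Summits.CriticalPhenomena.PercolationContinuityZ3.Theorems.PercNearOneGluingAdditiveGluingSigmaGeometry
import Summits.CriticalPhenomena.PercolationContinuityZ3.Theorems.PercNearOneGluingAdditiveGluingGoodStep24Engine
import HarnessLib

/-!
# `NoHeavyLowerTail` (stmt-CriticalPhenomena-4575) — near-one gluing for an ARBITRARY observer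
# when the relay core is self-reliant (k-uniform, depth-uniform)

Support file (hull-port / coupling seat `prim-hp-1` gen 5; `--supports stmt-CriticalPhenomena-4575`).
No definitions, no named facts, no sorries.  `μ = prodBernoulli w` on the pairs of `Fin n`, relays `A`,
target `b ∈ A`, observer `o ∉ A` of ARBITRARY depth; `w|_A` = `w` on the pairs inside `A`, `0` elsewhere
(percolation on the relay-induced subgraph `G[A]`).
* `sigmaRec_engine_soft` — SOFT form of Kozma–Nitzan's σ-recursion (arXiv:2401.12397, proofs of
  Thms 4–5; bookkeeping file `…AdditiveGluingSigmaRecursion`): absolute per-layer bounds (`≥ 1 − t`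
  reach on layers meeting `A`, deficit `≤ t` on Steiner layers) give deficit `≤ t` for the block; no
  designated relay, no Lemma 5.
* `relayCore_blockGluing` — for every glued block `O` disjoint from `A`:
  `μ_{glue O}(O ↔ A) − μ_{glue O}(O ↔ b) ≤ t` once `P_{G[A]}(a ↔ b) ≥ 1 − t` for all relays `a`
  (induction on the number of active non-relay vertices outside the block; a layer meeting `A` at `v`
  reaches `b` at least as well as `v` does in `G[A]`, by monotonicity in the weights; a Steiner layer is
  a smaller instance with the same core).
* `nearOneGluing_of_relayCore` / `nearOneGluing_of_relayCore'` — observer forms (`b ∈ A` / any `b ≠ o`,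
  core `G[A ∪ {b}]`): `P(o ↔ A) − t ≤ P(o ↔ b)`.
Kozma–Nitzan's Thm 4 restricts the observer (one layer) and allows any relay side; this restricts the
relay side (self-reliant core) and allows any observer.  Memo HULLPORT-COUPLING.md §43: what is left of the
crux is relay reliability CARRIED BY THE STEINER SKELETON that the observer's pocket can swallow.
-/

namespace Summit.CriticalPhenomena.PercolationContinuityZ3.Theorems

open MeasureTheory Set
open Literature.Probability.LatticeModels (prodBernoulli prodBernoulli_real_mono_of_isUpperSet)
open Literature.Probability.Percolation (BondConfig openConn openGraph isUpperSet_openConn)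

noncomputable section
open Classical

variable {n : ℕ}

/-! ### The soft σ-recursion engine -/

/-- **Soft σ-recursion engine.**  Same abstract ingredients as `sigmaRec_engine` (`p` = glued weights
of the block `O`, `q S` = weights of the block-deleted world with the layer `S` glued, `Ψ S` = the
off-block/glued configuration map, `K` = the conull clique event, geometry `hgeoA`/`hgeob`, law `hlaw`),
but with ABSOLUTE per-layer bounds: on positive layers meeting `A` (and missing `b`) the glued layer
reaches `b` with probability `≥ 1 − t` (`hrel`), on non-empty positive Steiner layers the deficit is
`≤ t` (`hdef`).  Conclusion: `μ_p(O ↔ A) − μ_p(O ↔ b) ≤ t`.  Proof: partition both probabilities by the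
value of the layer and compare termwise (`S = ∅`: the first term vanishes; `b ∈ S`: the second is the
whole layer mass). [cite: KozmaNitzan2024, proofs of Thms 4–5 (pp. 13–14) — bookkeeping only] -/
theorem sigmaRec_engine_soft (w p : Sym2 (Fin n) → unitInterval)
    (q : Finset (Fin n) → Sym2 (Fin n) → unitInterval) (O A : Finset (Fin n)) (b : Fin n) (t : ℝ)
    (Ψ : Finset (Fin n) → BondConfig (Fin n) → BondConfig (Fin n)) (K : Set (BondConfig (Fin n)))
    (hK : ∀ ω, ω ∉ K → ∃ e, p e = 1 ∧ e ∉ ω)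
    (hpO : ∀ o x : Fin n, x ∉ O → p s(o, x) = w s(o, x))
    (hgeoA : ∀ (S : Finset (Fin n)) (ω : BondConfig (Fin n)),
      (∀ x : Fin n, x ∈ S ↔ (x ∉ O ∧ ∃ o ∈ O, s(o, x) ∈ ω)) → ω ∈ K →
      (ω ∈ (⋃ o ∈ O, ⋃ x ∈ A, openConn o x) ↔ Ψ S ω ∈ (⋃ s ∈ S, ⋃ x ∈ A, openConn s x)))
    (hgeob : ∀ (S : Finset (Fin n)) (ω : BondConfig (Fin n)),
      (∀ x : Fin n, x ∈ S ↔ (x ∉ O ∧ ∃ o ∈ O, s(o, x) ∈ ω)) → ω ∈ K →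
      (ω ∈ (⋃ o ∈ O, openConn o b) ↔ Ψ S ω ∈ (⋃ s ∈ S, openConn s b)))
    (hlaw : ∀ (S : Finset (Fin n)) (E : Set (BondConfig (Fin n))),
      (prodBernoulli p).real
          ({ω | ∀ x : Fin n, x ∈ S ↔ (x ∉ O ∧ ∃ o ∈ O, s(o, x) ∈ ω)} ∩ {ω | Ψ S ω ∈ E}) =
        (prodBernoulli p).real {ω | ∀ x : Fin n, x ∈ S ↔ (x ∉ O ∧ ∃ o ∈ O, s(o, x) ∈ ω)} *
          (prodBernoulli (q S)).real E)
    (ht : 0 ≤ t)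
    (hrel : ∀ S : Finset (Fin n), (∀ x ∈ S, x ∉ O ∧ ∃ o ∈ O, w s(o, x) ≠ 0) →
      (S ∩ A).Nonempty → b ∉ S →
      1 - t ≤ (prodBernoulli (q S)).real (⋃ s ∈ S, openConn s b))
    (hdef : ∀ S : Finset (Fin n), (∀ x ∈ S, x ∉ O ∧ ∃ o ∈ O, w s(o, x) ≠ 0) →
      S.Nonempty → Disjoint S A → b ∉ S →
      (prodBernoulli (q S)).real (⋃ s ∈ S, ⋃ x ∈ A, openConn s x) -
          (prodBernoulli (q S)).real (⋃ s ∈ S, openConn s b) ≤ t) :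
    (prodBernoulli p).real (⋃ o ∈ O, ⋃ x ∈ A, openConn o x) -
        (prodBernoulli p).real (⋃ o ∈ O, openConn o b) ≤ t := by
  have hKc : prodBernoulli p Kᶜ = 0 := sigmaRec_conull p K hK
  -- factorisation of `μ(L_S ∩ F)` for an event `F` that is `Ψ_S⁻¹ F'` on `L_S ∩ K`
  have hfac : ∀ (S : Finset (Fin n)) (F F' : Set (BondConfig (Fin n))),
      (∀ ω : BondConfig (Fin n), (∀ x : Fin n, x ∈ S ↔ (x ∉ O ∧ ∃ o ∈ O, s(o, x) ∈ ω)) →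
        ω ∈ K → (ω ∈ F ↔ Ψ S ω ∈ F')) →
      (prodBernoulli p).real
          ({ω | ∀ x : Fin n, x ∈ S ↔ (x ∉ O ∧ ∃ o ∈ O, s(o, x) ∈ ω)} ∩ F) =
        (prodBernoulli p).real {ω | ∀ x : Fin n, x ∈ S ↔ (x ∉ O ∧ ∃ o ∈ O, s(o, x) ∈ ω)} *
          (prodBernoulli (q S)).real F' := by
    intro S F F' hFF'
    rw [← hlaw S F']
    exact sigmaRec_inter_congr p hKc fun ω hL hKω => hFF' ω hL hKω
  have hA : (prodBernoulli p).real (⋃ o ∈ O, ⋃ x ∈ A, openConn o x) =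
      ∑ S : Finset (Fin n),
        (prodBernoulli p).real {ω | ∀ x : Fin n, x ∈ S ↔ (x ∉ O ∧ ∃ o ∈ O, s(o, x) ∈ ω)} *
          (prodBernoulli (q S)).real (⋃ s ∈ S, ⋃ x ∈ A, openConn s x) := by
    rw [sigmaRec_partition p O]
    exact Finset.sum_congr rfl fun S _ => hfac S _ _ (hgeoA S)
  have hb : (prodBernoulli p).real (⋃ o ∈ O, openConn o b) =
      ∑ S : Finset (Fin n),
        (prodBernoulli p).real {ω | ∀ x : Fin n, x ∈ S ↔ (x ∉ O ∧ ∃ o ∈ O, s(o, x) ∈ ω)} *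
          (prodBernoulli (q S)).real (⋃ s ∈ S, openConn s b) := by
    rw [sigmaRec_partition p O]
    exact Finset.sum_congr rfl fun S _ => hfac S _ _ (hgeob S)
  have hone : ∑ S : Finset (Fin n),
      (prodBernoulli p).real {ω | ∀ x : Fin n, x ∈ S ↔ (x ∉ O ∧ ∃ o ∈ O, s(o, x) ∈ ω)} = 1 := by
    have h := sigmaRec_partition p O Set.univ
    simp only [Set.inter_univ, probReal_univ] at h
    exact h.symm
  rw [hA, hb, ← Finset.sum_sub_distrib]
  calc ∑ S : Finset (Fin n),
        ((prodBernoulli p).real {ω | ∀ x : Fin n, x ∈ S ↔ (x ∉ O ∧ ∃ o ∈ O, s(o, x) ∈ ω)} *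
            (prodBernoulli (q S)).real (⋃ s ∈ S, ⋃ x ∈ A, openConn s x) -
          (prodBernoulli p).real {ω | ∀ x : Fin n, x ∈ S ↔ (x ∉ O ∧ ∃ o ∈ O, s(o, x) ∈ ω)} *
            (prodBernoulli (q S)).real (⋃ s ∈ S, openConn s b))
      ≤ ∑ S : Finset (Fin n),
          (prodBernoulli p).real {ω | ∀ x : Fin n, x ∈ S ↔ (x ∉ O ∧ ∃ o ∈ O, s(o, x) ∈ ω)} * t := by
        refine Finset.sum_le_sum fun S _ => ?_
        rw [← mul_sub]
        rcases eq_or_ne ((prodBernoulli p).real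
          {ω | ∀ x : Fin n, x ∈ S ↔ (x ∉ O ∧ ∃ o ∈ O, s(o, x) ∈ ω)}) 0 with h0 | h0
        · rw [h0, zero_mul, zero_mul]
        refine mul_le_mul_of_nonneg_left ?_ measureReal_nonneg
        -- the termwise inequality on a positive layer
        have hS := sigmaRec_posLayer w p O S hpO h0
        have hα : (prodBernoulli (q S)).real (⋃ s ∈ S, ⋃ x ∈ A, openConn s x) ≤ 1 :=
          measureReal_le_one
        have hβ : 0 ≤ (prodBernoulli (q S)).real (⋃ s ∈ S, openConn s b) := measureReal_nonneg
        by_cases hSe : S = ∅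
        · subst hSe
          have h00 : (prodBernoulli (q ∅)).real
              (⋃ s ∈ (∅ : Finset (Fin n)), ⋃ x ∈ A, openConn s x) = 0 := by simp
          linarith
        by_cases hbS : b ∈ S
        · have h1 : (prodBernoulli (q S)).real (⋃ s ∈ S, openConn s b) = 1 := by
            have huniv : (⋃ s ∈ S, openConn s b : Set (BondConfig (Fin n))) = Set.univ :=
              Set.eq_univ_of_forall fun ω =>
                Set.mem_iUnion₂.2 ⟨b, hbS, (SimpleGraph.Reachable.refl b : ω ∈ openConn b b)⟩
            rw [huniv, probReal_univ]
          linarith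
        by_cases hSA : (S ∩ A).Nonempty
        · have h5 := hrel S hS hSA hbS
          linarith
        · exact hdef S hS (Finset.nonempty_iff_ne_empty.2 hSe)
            (Finset.disjoint_iff_inter_eq_empty.2 (Finset.not_nonempty_iff_eq_empty.1 hSA)) hbS
    _ = t := by rw [← Finset.sum_mul, hone, one_mul]

/-! ### The relay core: gluing for an arbitrary observer block -/

/-- The weights of the RELAY CORE `G[A]`: `w` on the pairs inside `A`, `0` elsewhere; they are dominated
pointwise by the weights of every layer world `glue_S (kill_O w)` of a block `O` disjoint from `A`. -/
theorem relayCore_le_layerWorld (w : Sym2 (Fin n) → unitInterval) (O A S : Finset (Fin n))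
    (hOA : Disjoint O A) :
    (fun e : Sym2 (Fin n) => if (∀ x ∈ e, x ∈ A) then w e else 0) ≤
      (fun e : Sym2 (Fin n) => if (∀ x ∈ e, x ∈ S) ∧ ¬ e.IsDiag then 1 else
        if (∃ x ∈ e, x ∈ O) then 0 else w e) := by
  intro e
  dsimp only
  by_cases hA : ∀ x ∈ e, x ∈ A
  · rw [if_pos hA]
    have hO : ¬ (∃ x ∈ e, x ∈ O) := by
      rintro ⟨x, hx, hxO⟩
      exact Finset.disjoint_left.1 hOA hxO (hA x hx)
    split_ifs with hS
    · exact le_top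
    · exact le_rfl
  · rw [if_neg hA]
    exact bot_le

/-- Killing a block disjoint from `A` does not change the relay core: `(kill_O w)|_A = w|_A`. -/
theorem relayCore_kill_eq (w : Sym2 (Fin n) → unitInterval) (O A : Finset (Fin n)) (hOA : Disjoint O A) :
    (fun e : Sym2 (Fin n) => if (∀ x ∈ e, x ∈ A) then
        (if (∃ x ∈ e, x ∈ O) then (0 : unitInterval) else w e) else 0) =
      (fun e : Sym2 (Fin n) => if (∀ x ∈ e, x ∈ A) then w e else 0) := by
  funext e
  by_cases hA : ∀ x ∈ e, x ∈ A
  · have hO : ¬ (∃ x ∈ e, x ∈ O) := by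
      rintro ⟨x, hx, hxO⟩
      exact Finset.disjoint_left.1 hOA hxO (hA x hx)
    rw [if_pos hA, if_pos hA, if_neg hO]
  · rw [if_neg hA, if_neg hA]

/-- **Relay-core gluing for an arbitrary glued observer block** (all `|A|`, all depths).  Weights `w` on the
pairs of `Fin n`, relays `A`, target `b ∈ A`, `0 ≤ t`, and the RELAY-CORE hypothesis
`P_{w|_A}(a ↔ b) ≥ 1 − t` for every `a ∈ A` (`w|_A` = `w` on the pairs inside `A`, `0` elsewhere).  Then for
every `m`, every weight function `w'` with the same core (`w'|_A = w|_A`) and every block `O` disjoint from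
`A` with at most `m` non-relay vertices outside `O` carrying a positive-weight pair:
`μ_{glue w' O}(O ↔ A) − μ_{glue w' O}(O ↔ b) ≤ t`.  Proof: induction on `m` through the soft engine
`sigmaRec_engine_soft` (geometry `stub_sigmaGeometry`, law `stub_sigmaLaw`): a positive layer `S`
meeting `A` at `v` reaches `b`, once glued, at least as well as `v` does in the core
(`prodBernoulli_real_mono_of_isUpperSet`, `relayCore_le_layerWorld`); a non-empty positive Steiner
layer is the induction hypothesis for the block `S` under `kill_O w'` (same core, `relayCore_kill_eq`;
fewer active non-relay vertices outside the block, since the vertices of `S` were active outside `O`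
and every vertex active outside `S` afterwards was active outside `O` before). -/
theorem relayCore_blockGluing (A : Finset (Fin n)) (b : Fin n) (hbA : b ∈ A) (t : ℝ) (ht : 0 ≤ t)
    (w : Sym2 (Fin n) → unitInterval)
    (hcore : ∀ a ∈ A, 1 - t ≤
      (prodBernoulli (fun e : Sym2 (Fin n) => if (∀ x ∈ e, x ∈ A) then w e else 0)).real
        (openConn a b)) :
    ∀ (m : ℕ) (w' : Sym2 (Fin n) → unitInterval) (O : Finset (Fin n)), Disjoint O A →
      (fun e : Sym2 (Fin n) => if (∀ x ∈ e, x ∈ A) then w' e else 0) =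
        (fun e : Sym2 (Fin n) => if (∀ x ∈ e, x ∈ A) then w e else 0) →
      (Finset.univ.filter fun x : Fin n =>
          x ∉ A ∧ x ∉ O ∧ ∃ y : Fin n, w' s(x, y) ≠ 0).card ≤ m →
      (prodBernoulli (fun e : Sym2 (Fin n) =>
          if (∀ x ∈ e, x ∈ O) ∧ ¬ e.IsDiag then 1 else w' e)).real
          (⋃ o ∈ O, ⋃ x ∈ A, openConn o x) -
        (prodBernoulli (fun e : Sym2 (Fin n) =>
          if (∀ x ∈ e, x ∈ O) ∧ ¬ e.IsDiag then 1 else w' e)).real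
          (⋃ o ∈ O, openConn o b) ≤ t := by
  intro m
  induction m with
  | zero =>
    intro w' O hOA hcoreq hcard
    exact step w' O hOA hcoreq (fun S hS hSne hSA => by
      -- no active non-relay vertex outside `O`: a non-empty positive Steiner layer is impossible
      exfalso
      obtain ⟨x, hx⟩ := hSne
      obtain ⟨hxO, o, ho, hw⟩ := hS x hx
      have hxA : x ∉ A := Finset.disjoint_left.1 hSA hx
      have hmem : x ∈ Finset.univ.filter fun x : Fin n =>
          x ∉ A ∧ x ∉ O ∧ ∃ y : Fin n, w' s(x, y) ≠ 0 :=
        Finset.mem_filter.2 ⟨Finset.mem_univ _, hxA, hxO, o, by rwa [Sym2.eq_swap]⟩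
      have := Finset.card_pos.2 ⟨x, hmem⟩
      omega)
  | succ m ih =>
    intro w' O hOA hcoreq hcard
    exact step w' O hOA hcoreq (fun S hS hSne hSA => by
      -- a non-empty positive Steiner layer: the induction hypothesis for the block `S` under `kill_O w'`
      refine ih (fun e : Sym2 (Fin n) => if (∃ x ∈ e, x ∈ O) then 0 else w' e) S hSA ?_ ?_
      · rw [relayCore_kill_eq w' O A hOA, hcoreq]
      · -- strictly fewer active non-relay vertices outside the block
        have hsub : (Finset.univ.filter fun x : Fin n =>
              x ∉ A ∧ x ∉ S ∧ ∃ y : Fin n,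
                (if (∃ z ∈ s(x, y), z ∈ O) then (0 : unitInterval) else w' s(x, y)) ≠ 0) ⊂
            (Finset.univ.filter fun x : Fin n => x ∉ A ∧ x ∉ O ∧ ∃ y : Fin n, w' s(x, y) ≠ 0) := by
          rw [Finset.ssubset_iff_subset_ne]
          refine ⟨fun x hx => ?_, fun heq => ?_⟩
          · obtain ⟨-, hxA, hxS, y, hy⟩ := Finset.mem_filter.1 hx
            have hO : ¬ (∃ z ∈ s(x, y), z ∈ O) := fun h => hy (by rw [if_pos h])
            rw [if_neg hO] at hy
            refine Finset.mem_filter.2 ⟨Finset.mem_univ _, hxA, fun hxO => hO ⟨x, Sym2.mem_mk_left x y, hxO⟩,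
              y, hy⟩
          · obtain ⟨x, hx⟩ := hSne
            obtain ⟨hxO, o, ho, hw⟩ := hS x hx
            have hxA : x ∉ A := Finset.disjoint_left.1 hSA hx
            have hmem : x ∈ Finset.univ.filter fun x : Fin n =>
                x ∉ A ∧ x ∉ O ∧ ∃ y : Fin n, w' s(x, y) ≠ 0 :=
              Finset.mem_filter.2 ⟨Finset.mem_univ _, hxA, hxO, o, by rwa [Sym2.eq_swap]⟩
            rw [← heq] at hmem
            exact (Finset.mem_filter.1 hmem).2.2.1 hx
        have hlt := Finset.card_lt_card hsub
        omega)
  where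
  /-- One application of the soft engine at the block `O`, given the bound on non-empty positive
  Steiner layers. -/
  step (w' : Sym2 (Fin n) → unitInterval) (O : Finset (Fin n)) (hOA : Disjoint O A)
      (hcoreq : (fun e : Sym2 (Fin n) => if (∀ x ∈ e, x ∈ A) then w' e else 0) =
        (fun e : Sym2 (Fin n) => if (∀ x ∈ e, x ∈ A) then w e else 0))
      (hSteiner : ∀ S : Finset (Fin n), (∀ x ∈ S, x ∉ O ∧ ∃ o ∈ O, w' s(o, x) ≠ 0) →
        S.Nonempty → Disjoint S A →
        (prodBernoulli (fun e : Sym2 (Fin n) =>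
            if (∀ x ∈ e, x ∈ S) ∧ ¬ e.IsDiag then 1 else
              if (∃ x ∈ e, x ∈ O) then 0 else w' e)).real (⋃ s ∈ S, ⋃ x ∈ A, openConn s x) -
          (prodBernoulli (fun e : Sym2 (Fin n) =>
            if (∀ x ∈ e, x ∈ S) ∧ ¬ e.IsDiag then 1 else
              if (∃ x ∈ e, x ∈ O) then 0 else w' e)).real (⋃ s ∈ S, openConn s b) ≤ t) :
      (prodBernoulli (fun e : Sym2 (Fin n) =>
          if (∀ x ∈ e, x ∈ O) ∧ ¬ e.IsDiag then 1 else w' e)).real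
          (⋃ o ∈ O, ⋃ x ∈ A, openConn o x) -
        (prodBernoulli (fun e : Sym2 (Fin n) =>
          if (∀ x ∈ e, x ∈ O) ∧ ¬ e.IsDiag then 1 else w' e)).real
          (⋃ o ∈ O, openConn o b) ≤ t := by
    have hbO : b ∉ O := fun h => Finset.disjoint_left.1 hOA h hbA
    refine sigmaRec_engine_soft w'
      (fun e : Sym2 (Fin n) => if (∀ x ∈ e, x ∈ O) ∧ ¬ e.IsDiag then 1 else w' e)
      (fun (S : Finset (Fin n)) (e : Sym2 (Fin n)) =>
        if (∀ x ∈ e, x ∈ S) ∧ ¬ e.IsDiag then 1 else if (∃ x ∈ e, x ∈ O) then 0 else w' e)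
      O A b t
      (fun (S : Finset (Fin n)) (ω : BondConfig (Fin n)) =>
        {e | e ∈ ω ∧ ∀ x ∈ e, x ∉ O} ∪ {e | (∀ x ∈ e, x ∈ S) ∧ ¬ e.IsDiag})
      {ω | ∀ o ∈ O, ∀ o' ∈ O, o ≠ o' → s(o, o') ∈ ω} ?_ ?_ ?_ ?_ (stub_sigmaLaw n w' O) ht ?_ ?_
    · -- outside the clique event some weight-1 pair is closed
      intro ω hω
      simp only [Set.mem_setOf_eq] at hω
      push Not at hω
      obtain ⟨o, ho, o', ho', hne, hnot⟩ := hω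
      refine ⟨s(o, o'), ?_, hnot⟩
      show (if (∀ y ∈ s(o, o'), y ∈ O) ∧ ¬ (s(o, o')).IsDiag then (1 : unitInterval)
        else w' s(o, o')) = 1
      rw [if_pos]
      refine ⟨fun y hy => ?_, fun hd => hne (Sym2.mk_isDiag_iff.1 hd)⟩
      rcases Sym2.mem_iff.1 hy with rfl | rfl <;> assumption
    · -- the glued weight of a pair leaving `O` is the original weight
      intro o x hx
      show (if (∀ y ∈ s(o, x), y ∈ O) ∧ ¬ (s(o, x)).IsDiag then (1 : unitInterval)
        else w' s(o, x)) = w' s(o, x)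
      rw [if_neg]
      rintro ⟨h, -⟩
      exact hx (h x (Sym2.mem_mk_right o x))
    · intro S ω hL hK
      exact (stub_sigmaGeometry n O S ω hL hK).1 A hOA
    · intro S ω hL hK
      have h := (stub_sigmaGeometry n O S ω hL hK).1 {b} (Finset.disjoint_singleton_right.2 hbO)
      simpa only [Finset.set_biUnion_singleton] using h
    · -- a positive layer meeting `A` at `v`: the glued layer reaches `b` at least as well as `v` in the core
      intro S _hS hSA hbS
      obtain ⟨v, hv⟩ := hSA
      have hvS : v ∈ S := (Finset.mem_inter.1 hv).1
      have hvA : v ∈ A := (Finset.mem_inter.1 hv).2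
      have h1 := hcore v hvA
      rw [← hcoreq] at h1
      have h2 : (prodBernoulli (fun e : Sym2 (Fin n) => if (∀ x ∈ e, x ∈ A) then w' e else 0)).real
            (openConn v b) ≤
          (prodBernoulli (fun e : Sym2 (Fin n) =>
            if (∀ x ∈ e, x ∈ S) ∧ ¬ e.IsDiag then 1 else
              if (∃ x ∈ e, x ∈ O) then 0 else w' e)).real (openConn v b) :=
        prodBernoulli_real_mono_of_isUpperSet (relayCore_le_layerWorld w' O A S hOA)
          (isUpperSet_openConn v b) MeasurableSet.of_discrete
      have h3 : (prodBernoulli (fun e : Sym2 (Fin n) =>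
            if (∀ x ∈ e, x ∈ S) ∧ ¬ e.IsDiag then 1 else
              if (∃ x ∈ e, x ∈ O) then 0 else w' e)).real (openConn v b) ≤
          (prodBernoulli (fun e : Sym2 (Fin n) =>
            if (∀ x ∈ e, x ∈ S) ∧ ¬ e.IsDiag then 1 else
              if (∃ x ∈ e, x ∈ O) then 0 else w' e)).real (⋃ s ∈ S, openConn s b) :=
        measureReal_mono (fun ω hω => Set.mem_iUnion₂.2 ⟨v, hvS, hω⟩) (measure_ne_top _ _)
      linarith
    · intro S hS hSne hSA _hbS
      exact hSteiner S hS hSne hSA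

/-- **Near-one gluing from a self-reliant relay core, for an observer of any depth.**  For bond percolation
with arbitrary edge probabilities `w` on `Fin n`, relays `A`, `o ∉ A`, `b ∈ A`, `0 ≤ t`: if every relay is
connected to `b` with probability `≥ 1 − t` USING ONLY PAIRS INSIDE `A` (`P_{w|_A}(a ↔ b) ≥ 1 − t`), then
`P(o ↔ A) − t ≤ P(o ↔ b)`.  (`relayCore_blockGluing` for the block `{o}`; Kozma–Nitzan's Conjecture 3
regime with the relay reliability read in the relay-induced subgraph; no restriction on the observer.)
[cite: KozmaNitzan2024, Thm. 4 and Conj. 3 (pp. 12–15) — context] -/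
theorem nearOneGluing_of_relayCore (n : ℕ) (w : Sym2 (Fin n) → unitInterval) (A : Finset (Fin n))
    (o b : Fin n) (t : ℝ) (ho : o ∉ A) (hb : b ∈ A) (ht : 0 ≤ t)
    (hcore : ∀ a ∈ A, 1 - t ≤
      (prodBernoulli (fun e : Sym2 (Fin n) => if (∀ x ∈ e, x ∈ A) then w e else 0)).real
        (openConn a b)) :
    (prodBernoulli w).real (⋃ a ∈ A, openConn o a) - t ≤ (prodBernoulli w).real (openConn o b) := by
  have hOA : Disjoint ({o} : Finset (Fin n)) A := Finset.disjoint_singleton_left.2 ho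
  have key := relayCore_blockGluing A b hb t ht w hcore n w {o} hOA rfl
    ((Finset.card_le_univ _).trans (Fintype.card_fin n).le)
  rw [goodStep24_glue_singleton, Finset.set_biUnion_singleton, Finset.set_biUnion_singleton] at key
  linarith

/-- **Near-one gluing from a self-reliant core, target outside `A`.**  Same as
`nearOneGluing_of_relayCore` with `b ∉ A` allowed: if `o ∉ A`, `o ≠ b`, `0 ≤ t` and every relay reaches
`b` with probability `≥ 1 − t` using only pairs inside `A ∪ {b}`, then `P(o ↔ A) − t ≤ P(o ↔ b)`.
[cite: KozmaNitzan2024, Conj. 3 (p. 15) — context] -/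
theorem nearOneGluing_of_relayCore' (n : ℕ) (w : Sym2 (Fin n) → unitInterval) (A : Finset (Fin n))
    (o b : Fin n) (t : ℝ) (ho : o ∉ A) (hob : o ≠ b) (ht : 0 ≤ t)
    (hcore : ∀ a ∈ A, 1 - t ≤
      (prodBernoulli (fun e : Sym2 (Fin n) => if (∀ x ∈ e, x ∈ insert b A) then w e else 0)).real
        (openConn a b)) :
    (prodBernoulli w).real (⋃ a ∈ A, openConn o a) - t ≤ (prodBernoulli w).real (openConn o b) := by
  have ho' : o ∉ insert b A := by
    rw [Finset.mem_insert]
    rintro (h | h)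
    · exact hob h
    · exact ho h
  have hcore' : ∀ a ∈ insert b A, 1 - t ≤
      (prodBernoulli (fun e : Sym2 (Fin n) => if (∀ x ∈ e, x ∈ insert b A) then w e else 0)).real
        (openConn a b) := by
    intro a ha
    rcases Finset.mem_insert.1 ha with rfl | ha
    · have huniv : (openConn a a : Set (BondConfig (Fin n))) = Set.univ :=
        Set.eq_univ_of_forall fun _ => SimpleGraph.Reachable.refl _
      rw [huniv, probReal_univ]
      linarith
    · exact hcore a ha
  have key := nearOneGluing_of_relayCore n w (insert b A) o b t ho' (Finset.mem_insert_self b A) ht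
    hcore'
  have hmono : (prodBernoulli w).real (⋃ a ∈ A, openConn o a) ≤
      (prodBernoulli w).real (⋃ a ∈ insert b A, openConn o a) :=
    measureReal_mono (Set.biUnion_subset_biUnion_left fun a (ha : a ∈ A) =>
      Finset.mem_insert_of_mem ha) (measure_ne_top _ _)
  linarith

end

end Summit.CriticalPhenomena.PercolationContinuityZ3.Theorems
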